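/-
Copyright (c) 2026 the pub-hodgecm-mathlib formalisation cell (harness21).  Prover seat hodgecm-mathlib-LH7-p08 (g3), req620 Track A «(D-RAM) FOUR-FRAME» squad
(STAGE-1b, row (2) of the piece `f_{T₊}`, the (β₂) road (R-36) «PURE-CELL LEDGER», K6 road; K6 desk LH4-p16 (g3) DESK WORD #6 (C) «(d″-Q) THE Q-NORMAL FORM PER SHELL + THE
SPLIT»; FILE Q1 — the inner shells and the diagonal ball by ONE mechanism, the class-flipping twist), 2026-09-05.
-/
import Summits.HodgeConjecture.HodgeConjecture.Theorems.F0P3cDyRamRowCellDigitClassSplit        -- ★ p864480 (this seat): (d′) class split; brings ★ p863914 §0, ★ p863859 `fixedNorm_*`, ★ Lit norm-sign conductor lemmas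
import Summits.HodgeConjecture.HodgeConjecture.Theorems.F0P3cDyRamRowCellDigitShellDictionary   -- ★ p864361 (this seat): K6-(d) `v_traceOne_add_map_mul_anti_eq_max`, ★ `one_le_v_of_trace_one`
import Summits.HodgeConjecture.HodgeConjecture.Theorems.F0P3cDyRamRowVertexAffineCoordinate     -- ★ p862871 (LH4-p16 (g2)): `exists_doublyFixed_coord`
import HarnessLib

/-!
# Crux `H413`, line LH4 «(D-RAM) FOUR-FRAME» — STAGE-1b, row (2), the (β₂) road (R-36), K6-(d″-Q) FILE Q1: «THE CLASS-FLIPPING TWIST — INNER SHELLS (AND THE DIAGONAL BALL)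
# ARE BALANCED» — multiplying a point of the line by a near-`1` unit of non-norm `ρ`-norm and re-normalising the trace is a class-flipping isometric bijection of every sphere
# of radius `< |ϖE|^{−(2d−2)}`; hence on each such shell the digits of the two literal classes are EQUINUMEROUS

Cell `hodgecm-mathlib` (D-0151), FLOOR 0, crux item H413 = `stmt-HodgeConjecture-24833`, route of record `HCCMUnconditional`; squad F0∕P3c∕LH7 (hand lent to the LH4 β₂ board);
lane `--supports stmt-HodgeConjecture-24833 --as helper` (count-neutral; pays NO tier-0 row).  THEOREMS ONLY (no `def`, no instance, no notation, no `sorry`, default heartbeats);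
★-only imports; states NO law; (β₂) stays a HYPOTHESIS.

WHAT (K6 desk LH4-p16 (g3) WORD #6 (C); consumers: LH7-p06 (g3)'s ★ p864447 `density_of_tables` letters `hL0` (diagonal half–half) and `hLNear` (inner shells half–half), read together
with the (d″-T) shell totals ★ `…OneChartDigitTotals`).  CURRENCY: the ONE chart of ★ p864361 §7 — a point `κ₀` of `ρ`-trace one, `Θ`-fixed, `|κ₀| = 1`; a direction `ξ₀` (`ρξ₀ = −ξ₀`,
`Θξ₀ = ξ₀ ≠ 0`); digits `V : E` (`σ`-fixed, integral) with points `κ_V := κ₀ + jE V·ξ₀`, spheres `max 1 (|V|·|ξ₀|) = R` (★ `sphereClause_iff_max_eq`), and the class predicate of a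
doubly-fixed scalar `c ≠ 0` (`c = hρh` ∕ `h′ρh′`): `CLASS_c V :≡ ∃ e, ρe = e ∧ eΘe = κ_V·ρκ_V ∕ c`.
* §1 `fixedNorm_of_v_sub_one_le` — a doubly-fixed `u` with `|u − 1| ≤ |jE ϖ|^{2d−1}` is in `𝒩` (★ Lit `exists_mul_map_eq_of_fixed_of_v_sub_one_le_pred` through `jE`);
  `exists_twistUnit` — THE TWIST UNIT: from the ★ Lit non-norm fixed unit `u₀ ≡ 1 (ϖ^{2d−2})` (`exists_fixed_unit_not_norm_v_sub_one_le`), `η := 1 + jE t₀·κ₀` (`t₀ = u₀ − 1`) is `Θ`-fixed,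
  `|η − 1| ≤ |ϖ|^{2d−2}` and `N_ρ(η) = jE u₀ + jE t₀²·N_ρ(κ₀) ∉ 𝒩` (`2 ≤ d`).
* §2 THE TWIST `T_η(κ) := ηκ ∕ Tr_ρ(ηκ)`: `twist_trace_eq` (`Tr_ρ(ηκ) = 1 + jE t₀·Tr_ρ(κ₀κ)`), `twist_line_letters` (trace one, `Θ`-fixed, `N_ρ(Tκ) = N_ρ(η)·N_ρ(κ) ∕ Tr_ρ(ηκ)²`),
  `twist_sub_twist` (`Tκ₁ − Tκ₂ = ηρη·(κ₁ − κ₂) ∕ (τ₁τ₂)` — an ISOMETRY where `|τ| = 1`), `twist_twist_inv` (`T_{η⁻¹} ∘ T_η = id`), `twist_size_letters` (on a sphere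
  `R·|ϖ|^{2d−2} < 1`: `|τ − 1| < 1`, `|τ| = 1`, `|Tκ| = |κ|`), `classClause_twist_iff_not` (the class FLIPS: index two, ★ `fixedNorm_mul_iff_iff`).
* §3 HEAD `card_filter_class_eq_card_filter_not_class` — «INNER SHELLS AND THE DIAGONAL BALL ARE BALANCED»: for a `σ`-fixed integral digit system `Rd`, complete and separated at
  precision `r` (★ p863833's `hRd2∕hRd3`), a sphere `R` with `1 ≤ R ≤ |ξ₀|`, `R·|ϖ|^{2d−2} < 1` (cells `i ≤ d − 2`, INCLUDING the diagonal `R = 1`), `r·|ξ₀| < R` and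
  `r·|ξ₀| ≤ |ϖ|^{2d−1}·R`: `#((Rd.filter shell_R).filter CLASS_c) = #((Rd.filter shell_R).filter ¬CLASS_c)` — the digit map `V ↦` (the digit within `r` of the coordinate of
  `T κ_V`) is a class-flipping injection of the shell into itself (isometry + separation), both ways.
WHAT IS NOT CLAIMED: the boundary shell `i = d − 1` (`R·|ϖ|^{2d−2} = 1`: the twist leaves the sphere on one residue class — the `(q−2) : q` split, FILE Q2), the far shells (★ p864480),
the shell totals ((d″-T), LH7-p06 (g3)), any census identity.
HONEST LABEL.  Count-neutral field algebra and finite bookkeeping; nothing printed is asserted; no census law is stated; `HC_CM` is proved only modulo the 7 printed citations (2 remaining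
named inputs: hLiu418 = `stmt-HodgeConjecture-24832`, h413 = `stmt-HodgeConjecture-24833`) until rung 0 closes.
## References
* [Serre1979] J.-P. Serre, *Local Fields*, GTM 67 (1979): Ch. V §2 Prop. 3 p. 81 (unramified: `N(1 + 𝔭ⁿ_K) = 1 + 𝔭ⁿ_F`), Ch. V §3 Prop. 5, Cor. 2–3 pp. 84–86 (norm index two, norms
  near `1`), Ch. XV §2 (conductor).
* [Flicker1998UnitaryFL] Y. Z. Flicker, *Elementary proof of the fundamental lemma for a unitary group*, Canad. J. Math. 50 (1998): Prop. 7 p. 84 (type RamK census by classes).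
* [Kottwitz1986BaseChangeUnits] R. E. Kottwitz, *Base change for unit elements of Hecke algebras*, Compositio Math. 60 (1986): §1 pp. 240–241 (fixed-lattice counts as orbital integrals).
* [LabesseLanglands1979] J.-P. Labesse, R. P. Langlands, *L-indistinguishability for SL(2)*, Canad. J. Math. 31 (1979): §2 (2.2) p. 9 (κ-signed counts: the twist by a non-norm).
-/

set_option autoImplicit false

noncomputable section

namespace Summit.HodgeConjecture.HodgeConjecture.Cruxes.H413.F0P3cDyRamRowCellDigitClassTwist

open scoped Valued WithZero
open WithZero Finset
open Literature.NumberTheory.Automorphic.UnitaryThreeFourFrame (IsRamifiedQuadraticDatum)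
open Literature.NumberTheory.LocalFields.WildQuadraticDatum (exists_mul_map_eq_of_fixed_of_v_sub_one_le_pred exists_fixed_unit_not_norm_v_sub_one_le)
open Summit.HodgeConjecture.HodgeConjecture.Cruxes.H413.F0P3cDyRamRowVertexPopulationRead (fixedNorm_mul fixedNorm_inv fixedNorm_mul_iff fixedNorm_map_iff fixedNorm_sq fixedNorm_mul_iff_iff)
open Summit.HodgeConjecture.HodgeConjecture.Cruxes.H413.F0P3cDyRamRowCellSocketReads (exists_indexTwo_letters)
open Summit.HodgeConjecture.HodgeConjecture.Cruxes.H413.F0P3cDyRamSphereCellGenerator (one_le_v_of_trace_one)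
open Summit.HodgeConjecture.HodgeConjecture.Cruxes.H413.F0P3cDyRamRowCellDigitShellDictionary (v_traceOne_add_map_mul_anti_eq_max)
open Summit.HodgeConjecture.HodgeConjecture.Cruxes.H413.F0P3cDyRamRowVertexAffineCoordinate (exists_doublyFixed_coord)

variable {E M : Type} [Field E] [Valued E ℤᵐ⁰] [Field M] [Valued M ℤᵐ⁰] {ρ Θ : M →+* M} {α : M}

/-! ## §1 Norms near `1`; the twist unit -/

/-- **A DOUBLY-FIXED ELEMENT WITHIN `|ϖE|^{2d−1}` OF `1` IS IN `𝒩`** (`jE`-letters on a complete `E` with the wild datum; ★ Lit `exists_mul_map_eq_of_fixed_of_v_sub_one_le_pred` pulled back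
through `jE`). [cite: Serre1979, Ch. V §3 Prop. 5, Cor. 2–3 pp. 84–86; Ch. XV §2] -/
theorem fixedNorm_of_v_sub_one_le [CompleteSpace E] {σ : E →+* E} {ϖ : E} {d tE : ℕ} (hD : IsRamifiedQuadraticDatum σ ϖ d tE)
    (jE : E →+* M) (hjfix : ∀ z, ρ z = z ↔ ∃ c, jE c = z) (hΘj : ∀ c, Θ (jE c) = jE (σ c)) (hjiso : ∀ a, Valued.v (jE a) = Valued.v a)
    {u : M} (hρu : ρ u = u) (hΘu : Θ u = u) (hu : Valued.v (u - 1) ≤ Valued.v (jE ϖ) ^ (2 * d - 1)) :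
    ∃ e : M, ρ e = e ∧ e * Θ e = u := by
  obtain ⟨uE, huE⟩ := (hjfix u).1 hρu
  have hσuE : σ uE = uE := jE.injective (by rw [← hΘj, huE, hΘu])
  have huEv : Valued.v (uE - 1) ≤ Valued.v ϖ ^ (2 * d - 1) := by
    rw [← hjiso, map_sub, map_one, huE, ← hjiso ϖ]; exact hu
  obtain ⟨t, ht⟩ := exists_mul_map_eq_of_fixed_of_v_sub_one_le_pred hD hσuE le_rfl huEv
  rw [← huE]; exact (fixedNorm_map_iff jE hjfix hΘj uE).2 ⟨t, ht⟩

/-- **THE TWIST UNIT.**  `jE`-letters on a complete `E` with finite residue field, the wild datum `IsRamifiedQuadraticDatum σ ϖ d tE`, `|2| < 1`, `2 ≤ d`; `ρ² = 1`; a `Θ`-fixed point `κ₀`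
of `ρ`-trace one with `|κ₀| = 1`.  THEN there is `t₀ : E` with `σt₀ = t₀`, `|t₀| ≤ |ϖ|^{2d−2}`, `Θ(1 + jE t₀·κ₀) = 1 + jE t₀·κ₀`, `|jE t₀·κ₀| < 1`, and
`N_ρ(1 + jE t₀·κ₀) ∉ 𝒩` — take the ★ Lit non-norm unit `u₀ ≡ 1 (ϖ^{2d−2})`, `t₀ := u₀ − 1`: `N_ρ(1 + t₀κ₀) = jE u₀·(1 + jE t₀²·N_ρκ₀ ∕ jE u₀)` and the second factor is a norm (§1,
`|t₀²| ≤ |ϖ|^{4d−4} ≤ |ϖ|^{2d−1}`). [cite: Serre1979, Ch. V §3 Prop. 5, Cor. 2–3 pp. 84–86; Ch. XV §2] [cite: LabesseLanglands1979, §2 (2.2) p. 9] -/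
theorem exists_twistUnit [CompleteSpace E] [Finite 𝓀[E]] {σ : E →+* E} {ϖ : E} {d tE : ℕ} (hD : IsRamifiedQuadraticDatum σ ϖ d tE)
    (h2v : Valued.v (2 : E) < 1) (hd2 : 2 ≤ d)
    (jE : E →+* M) (hjfix : ∀ z, ρ z = z ↔ ∃ c, jE c = z) (hΘj : ∀ c, Θ (jE c) = jE (σ c)) (hjiso : ∀ a, Valued.v (jE a) = Valued.v a)
    (hρρ : ∀ x, ρ (ρ x) = x) (hvρ : ∀ x, Valued.v (ρ x) = Valued.v x) (hΘρ : ∀ x, Θ (ρ x) = ρ (Θ x))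
    {κ₀ : M} (hκ₀ : κ₀ + ρ κ₀ = 1) (hΘκ₀ : Θ κ₀ = κ₀) (hκ₀1 : Valued.v κ₀ = 1) :
    ∃ t₀ : E, σ t₀ = t₀ ∧ Valued.v t₀ ≤ Valued.v ϖ ^ (2 * d - 2) ∧ Θ (1 + jE t₀ * κ₀) = 1 + jE t₀ * κ₀ ∧ Valued.v (jE t₀ * κ₀) < 1 ∧
      ¬ ∃ e : M, ρ e = e ∧ e * Θ e = (1 + jE t₀ * κ₀) * ρ (1 + jE t₀ * κ₀) := by
  obtain ⟨-, -, hϖ, -, -, hd1, -⟩ := id hD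
  have hρj : ∀ c : E, ρ (jE c) = jE c := fun c => (hjfix _).2 ⟨c, rfl⟩
  have hϖpow : ∀ k : ℕ, Valued.v ϖ ^ k = exp (-(k : ℤ)) := fun k => by
    rw [hϖ, ← exp_nsmul, nsmul_eq_mul, mul_neg, mul_one]
  obtain ⟨u₀, hσu₀, hu₀1, hu₀near, hu₀n⟩ := exists_fixed_unit_not_norm_v_sub_one_le hD h2v
  refine ⟨u₀ - 1, by rw [map_sub, hσu₀, map_one], ?_, ?_, ?_, ?_⟩
  · rw [hϖpow]; refine hu₀near.trans ?_; rw [exp_le_exp]; omega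
  · rw [map_add, map_one, map_mul, hΘj, map_sub, hσu₀, map_one, hΘκ₀]
  · rw [Valuation.map_mul, hκ₀1, mul_one, hjiso]
    refine lt_of_le_of_lt hu₀near ?_
    rw [← exp_zero, exp_lt_exp]; omega
  · -- `N_ρ(1 + t₀κ₀) = jE u₀ · v` with `v ≡ 1 (ϖ^{2d−1})` a norm
    intro hN
    have hu₀0 : u₀ ≠ 0 := fun h0 => by rw [h0, map_zero] at hu₀1; exact zero_ne_one hu₀1
    have hju₀ : jE u₀ ≠ 0 := (map_ne_zero jE).2 hu₀0
    set t₀ : E := u₀ - 1 with ht₀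
    have hσt₀ : σ t₀ = t₀ := by rw [ht₀, map_sub, hσu₀, map_one]
    set Nη : M := (1 + jE t₀ * κ₀) * ρ (1 + jE t₀ * κ₀) with hNηdef
    have hNη : Nη = jE u₀ + jE (t₀ * t₀) * (κ₀ * ρ κ₀) := by
      have eu : jE u₀ = 1 + jE t₀ := by rw [ht₀, map_sub, map_one]; ring
      rw [hNηdef, map_add, map_one, map_mul, hρj, map_mul, eu]
      linear_combination (jE t₀) * hκ₀
    have hρNη : ρ Nη = Nη := by rw [hNηdef, map_mul, hρρ, mul_comm]
    have hΘ1 : Θ (1 + jE t₀ * κ₀) = 1 + jE t₀ * κ₀ := by rw [map_add, map_one, map_mul, hΘj, hσt₀, hΘκ₀]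
    have hΘNη : Θ Nη = Nη := by rw [hNηdef, map_mul, hΘ1, hΘρ, hΘ1]
    set v : M := Nη / jE u₀ with hv
    have hρv : ρ v = v := by rw [hv, map_div₀, hρNη, hρj]
    have hΘv : Θ v = v := by rw [hv, map_div₀, hΘNη, hΘj, hσu₀]
    have hv1 : v - 1 = jE (t₀ * t₀) * (κ₀ * ρ κ₀) / jE u₀ := by
      rw [hv, hNη, eq_div_iff hju₀, sub_mul, div_mul_cancel₀ _ hju₀]; ring
    have hvnear : Valued.v (v - 1) ≤ Valued.v (jE ϖ) ^ (2 * d - 1) := by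
      rw [hv1, map_div₀, Valuation.map_mul, Valuation.map_mul, hvρ, hκ₀1, mul_one, mul_one, hjiso, hjiso, hu₀1, div_one, map_mul, hjiso,
        hϖpow]
      have ht : Valued.v t₀ ≤ exp (-(((2 * d - 2 : ℕ) : ℤ))) := by
        refine hu₀near.trans ?_; rw [exp_le_exp]; omega
      calc Valued.v t₀ * Valued.v t₀ ≤ exp (-(((2 * d - 2 : ℕ) : ℤ))) * exp (-(((2 * d - 2 : ℕ) : ℤ))) := mul_le_mul' ht ht
        _ ≤ exp (-(((2 * d - 1 : ℕ) : ℤ))) := by rw [← exp_add, exp_le_exp]; omega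
    have hvN : ∃ e : M, ρ e = e ∧ e * Θ e = v := fixedNorm_of_v_sub_one_le hD jE hjfix hΘj hjiso hρv hΘv hvnear
    have hv0 : v ≠ 0 := by
      intro h0
      have h1 : Valued.v (v - 1) = 1 := by rw [h0, zero_sub, Valuation.map_neg, Valuation.map_one]
      rw [h1, hjiso, hϖpow, ← exp_zero, exp_le_exp] at hvnear
      omega
    have hNv : Nη = jE u₀ * v := by rw [hv, mul_div_cancel₀ _ hju₀]
    rw [hNv] at hN
    have hu₀N : ∃ e : M, ρ e = e ∧ e * Θ e = jE u₀ := (fixedNorm_mul_iff hv0 hvN).1 hN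
    exact hu₀n ((fixedNorm_map_iff jE hjfix hΘj u₀).1 hu₀N)

/-! ## §2 The twist `T_η(κ) = ηκ ∕ Tr_ρ(ηκ)` -/

omit [Field E] [Valued E ℤᵐ⁰] [Valued M ℤᵐ⁰] in
/-- **THE TRACE OF THE TWISTED POINT**: for `η = 1 + s·κ₀` with `ρs = s` and a point `κ` of `ρ`-trace one, `Tr_ρ(ηκ) = 1 + s·Tr_ρ(κ₀κ)`. [cite: Serre1979, Ch. V §2 Prop. 3 p. 81] -/
theorem twist_trace_eq {s κ₀ κ : M} (hρs : ρ s = s) (hκ : κ + ρ κ = 1) :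
    (1 + s * κ₀) * κ + ρ ((1 + s * κ₀) * κ) = 1 + s * (κ₀ * κ + ρ (κ₀ * κ)) := by
  rw [map_mul, map_add, map_one, map_mul, hρs, map_mul]; linear_combination hκ

omit [Field E] [Valued E ℤᵐ⁰] [Valued M ℤᵐ⁰] in
/-- **THE TWISTED POINT IS ON THE LINE, `Θ`-FIXED, WITH NORM `N_ρ(η)·N_ρ(κ) ∕ τ²`** (`τ := Tr_ρ(ηκ) ≠ 0`; `ρ² = 1`, `Θρ = ρΘ`, `Θη = η`, `Θκ = κ`).
[cite: Serre1979, Ch. V §2 Prop. 3 p. 81] [cite: LabesseLanglands1979, §2 (2.2) p. 9] -/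
theorem twist_line_letters (hρρ : ∀ x, ρ (ρ x) = x) (hΘρ : ∀ x, Θ (ρ x) = ρ (Θ x)) {η κ : M} (hΘη : Θ η = η) (hΘκ : Θ κ = κ)
    (hτ : η * κ + ρ (η * κ) ≠ 0) :
    η * κ / (η * κ + ρ (η * κ)) + ρ (η * κ / (η * κ + ρ (η * κ))) = 1 ∧ Θ (η * κ / (η * κ + ρ (η * κ))) = η * κ / (η * κ + ρ (η * κ)) ∧
      (η * κ / (η * κ + ρ (η * κ))) * ρ (η * κ / (η * κ + ρ (η * κ))) = (η * ρ η) * (κ * ρ κ) / ((η * κ + ρ (η * κ)) * (η * κ + ρ (η * κ))) := by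
  have hρτ : ρ (η * κ + ρ (η * κ)) = η * κ + ρ (η * κ) := by rw [map_add, hρρ, add_comm]
  have hΘτ : Θ (η * κ + ρ (η * κ)) = η * κ + ρ (η * κ) := by rw [map_add, map_mul, hΘη, hΘκ, hΘρ, map_mul, hΘη, hΘκ]
  refine ⟨?_, by rw [map_div₀, map_mul, hΘη, hΘκ, hΘτ], ?_⟩
  · rw [map_div₀, hρτ, ← add_div, div_self hτ]
  · rw [map_div₀, hρτ, map_mul, div_mul_div_comm]; ring

omit [Field E] [Valued E ℤᵐ⁰] [Valued M ℤᵐ⁰] in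
/-- **THE TWIST IS AN ISOMETRY UP TO THE TRACES**: for two points `κ₁, κ₂` of `ρ`-trace one, `T κ₁ − T κ₂ = η·ρη·(κ₁ − κ₂) ∕ (τ₁·τ₂)` (`τᵢ := Tr_ρ(ηκᵢ) ≠ 0`; `ρ² = 1`).
[cite: Serre1979, Ch. V §2 Prop. 3 p. 81] -/
theorem twist_sub_twist {η κ₁ κ₂ : M} (h₁ : κ₁ + ρ κ₁ = 1) (h₂ : κ₂ + ρ κ₂ = 1)
    (hτ₁ : η * κ₁ + ρ (η * κ₁) ≠ 0) (hτ₂ : η * κ₂ + ρ (η * κ₂) ≠ 0) :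
    η * κ₁ / (η * κ₁ + ρ (η * κ₁)) - η * κ₂ / (η * κ₂ + ρ (η * κ₂)) = η * ρ η * (κ₁ - κ₂) / ((η * κ₁ + ρ (η * κ₁)) * (η * κ₂ + ρ (η * κ₂))) := by
  rw [div_sub_div _ _ hτ₁ hτ₂, map_mul, map_mul]
  congr 1
  have e₁ : ρ κ₁ = 1 - κ₁ := by linear_combination h₁
  have e₂ : ρ κ₂ = 1 - κ₂ := by linear_combination h₂
  rw [e₁, e₂]; ring

omit [Field E] [Valued E ℤᵐ⁰] [Valued M ℤᵐ⁰] in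
/-- **THE TWIST IS INVERTIBLE: `T_{η⁻¹}(T_η κ) = κ`** (`Tr_ρ κ = 1`, `η ≠ 0`, `Tr_ρ(ηκ) ≠ 0`; `ρ² = 1`, `Fix ρ`-scalars pass through `Tr_ρ`). [cite: Serre1979, Ch. V §2 Prop. 3 p. 81] -/
theorem twist_twist_inv (hρρ : ∀ x, ρ (ρ x) = x) {η κ : M} (hη : η ≠ 0) (hκ : κ + ρ κ = 1) (hτ : η * κ + ρ (η * κ) ≠ 0) :
    η⁻¹ * (η * κ / (η * κ + ρ (η * κ))) / (η⁻¹ * (η * κ / (η * κ + ρ (η * κ))) + ρ (η⁻¹ * (η * κ / (η * κ + ρ (η * κ))))) = κ := by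
  set τ : M := η * κ + ρ (η * κ) with hτdef
  have hρτ : ρ τ = τ := by rw [hτdef, map_add, hρρ, add_comm]
  have e1 : η⁻¹ * (η * κ / τ) = κ / τ := by field_simp
  have e2 : η⁻¹ * (η * κ / τ) + ρ (η⁻¹ * (η * κ / τ)) = 1 / τ := by rw [e1, map_div₀, hρτ, ← add_div, hκ]
  rw [e2, e1]
  field_simp

/-- **THE SIZES ON AN INNER SPHERE.**  `ρ` isometric; `η = 1 + s·κ₀` with `ρs = s`, `|κ₀| = 1`, `|s|·|κ| < 1` (an inner sphere: `|s| ≤ |ϖ|^{2d−2}`, `|κ|·|ϖ|^{2d−2} < 1`); `Tr_ρ κ = 1`.  THEN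
`|Tr_ρ(ηκ) − 1| < 1`, `|Tr_ρ(ηκ)| = 1`, `Tr_ρ(ηκ) ≠ 0`, `|η| = 1` and `|T κ| = |κ|`. [cite: Serre1979, Ch. V §2 Prop. 3 p. 81] -/
theorem twist_size_letters (hvρ : ∀ x, Valued.v (ρ x) = Valued.v x) {s κ₀ κ : M} (hρs : ρ s = s) (hκ₀1 : Valued.v κ₀ = 1) (hκ : κ + ρ κ = 1)
    (hsmall : Valued.v s * Valued.v κ < 1) :
    Valued.v ((1 + s * κ₀) * κ + ρ ((1 + s * κ₀) * κ) - 1) < 1 ∧ Valued.v ((1 + s * κ₀) * κ + ρ ((1 + s * κ₀) * κ)) = 1 ∧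
      (1 + s * κ₀) * κ + ρ ((1 + s * κ₀) * κ) ≠ 0 ∧ Valued.v (1 + s * κ₀) = 1 ∧
      Valued.v ((1 + s * κ₀) * κ / ((1 + s * κ₀) * κ + ρ ((1 + s * κ₀) * κ))) = Valued.v κ := by
  have hκge : 1 ≤ Valued.v κ := one_le_v_of_trace_one hvρ hκ
  have hs1 : Valued.v (s * κ₀) < 1 := by
    rw [Valuation.map_mul, hκ₀1, mul_one]
    calc Valued.v s = Valued.v s * 1 := (mul_one _).symm
      _ ≤ Valued.v s * Valued.v κ := by gcongr
      _ < 1 := hsmall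
  have hη1 : Valued.v (1 + s * κ₀) = 1 := by
    rw [Valuation.map_add_eq_of_lt_left _ (by rw [Valuation.map_one]; exact hs1), Valuation.map_one]
  have hτ1 : Valued.v ((1 + s * κ₀) * κ + ρ ((1 + s * κ₀) * κ) - 1) < 1 := by
    rw [twist_trace_eq hρs hκ, add_sub_cancel_left, Valuation.map_mul]
    refine lt_of_le_of_lt (mul_le_mul' le_rfl ((Valuation.map_add _ _ _).trans (max_le ?_ ?_))) hsmall
    · rw [Valuation.map_mul, hκ₀1, one_mul]
    · rw [hvρ, Valuation.map_mul, hκ₀1, one_mul]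
  have hτv : Valued.v ((1 + s * κ₀) * κ + ρ ((1 + s * κ₀) * κ)) = 1 := by
    have e : (1 + s * κ₀) * κ + ρ ((1 + s * κ₀) * κ) = 1 + ((1 + s * κ₀) * κ + ρ ((1 + s * κ₀) * κ) - 1) := by ring
    rw [e, Valuation.map_add_eq_of_lt_left _ (by rw [Valuation.map_one]; exact hτ1), Valuation.map_one]
  have hτ0 : (1 + s * κ₀) * κ + ρ ((1 + s * κ₀) * κ) ≠ 0 := fun h0 => by rw [h0, Valuation.map_zero] at hτv; exact zero_ne_one hτv
  exact ⟨hτ1, hτv, hτ0, hη1, by rw [map_div₀, hτv, div_one, Valuation.map_mul, hη1, one_mul]⟩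

omit [Field E] [Valued E ℤᵐ⁰] [Valued M ℤᵐ⁰] in
/-- **THE TWIST FLIPS THE CLASS.**  Index-two letters (`c₀ ∉ 𝒩` doubly fixed with the dichotomy, ★ p863914 §0); `η` with `Θη = η`, `η ≠ 0`, `N_ρ(η) ∉ 𝒩`; a doubly-fixed scalar
`c ≠ 0`; a point `κ ≠ 0` of the line (`Tr_ρ κ = 1`, `Θκ = κ`) with `τ = Tr_ρ(ηκ) ≠ 0` (`ρ² = 1`, `Θρ = ρΘ`).  THEN `N_ρ(Tκ) ∕ c ∈ 𝒩 ↔ N_ρ(κ) ∕ c ∉ 𝒩` (`N_ρ(Tκ)∕c = (N_ρκ∕c)·(N_ρη∕τ²)` and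
`N_ρη ∕ τ²` is a doubly-fixed non-norm; ★ `fixedNorm_mul_iff_iff`). [cite: Serre1979, Ch. V §3 Prop. 5, Cor. 2–3 pp. 84–86] [cite: LabesseLanglands1979, §2 (2.2) p. 9] -/
theorem classClause_twist_iff_not (hρρ : ∀ x, ρ (ρ x) = x) (hΘρ : ∀ x, Θ (ρ x) = ρ (Θ x))
    {c₀ : M} (hρc₀ : ρ c₀ = c₀) (hΘc₀ : Θ c₀ = c₀) (hc₀n : ¬ ∃ e : M, ρ e = e ∧ e * Θ e = c₀)
    (hdich : ∀ u : M, ρ u = u → Θ u = u → u ≠ 0 → (∃ e : M, ρ e = e ∧ e * Θ e = u) ∨ ∃ e : M, ρ e = e ∧ e * Θ e = c₀ * u)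
    {η : M} (hΘη : Θ η = η) (hη : η ≠ 0) (hηN : ¬ ∃ e : M, ρ e = e ∧ e * Θ e = η * ρ η)
    {c : M} (hρc : ρ c = c) (hΘc : Θ c = c) (hc : c ≠ 0)
    {κ : M} (hκ : κ + ρ κ = 1) (hΘκ : Θ κ = κ) (hτ : η * κ + ρ (η * κ) ≠ 0) :
    (∃ e : M, ρ e = e ∧ e * Θ e = (η * κ / (η * κ + ρ (η * κ))) * ρ (η * κ / (η * κ + ρ (η * κ))) / c) ↔
      ¬ ∃ e : M, ρ e = e ∧ e * Θ e = κ * ρ κ / c := by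
  obtain ⟨-, -, hN⟩ := twist_line_letters hρρ hΘρ hΘη hΘκ hτ
  set τ : M := η * κ + ρ (η * κ) with hτdef
  have hρτ : ρ τ = τ := by rw [hτdef, map_add, hρρ, add_comm]
  have hΘτ : Θ τ = τ := by rw [hτdef, map_add, map_mul, hΘη, hΘκ, hΘρ, map_mul, hΘη, hΘκ]
  have hκ0 : κ ≠ 0 := fun h0 => by rw [h0, map_zero, add_zero] at hκ; exact zero_ne_one hκ
  -- `N(Tκ)/c = (κρκ/c) · (ηρη/τ²)`
  have e : (η * κ / τ) * ρ (η * κ / τ) / c = (κ * ρ κ / c) * (η * ρ η / (τ * τ)) := by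
    rw [hN]; field_simp
  rw [e]
  have hρx : ρ (κ * ρ κ / c) = κ * ρ κ / c := by rw [map_div₀, map_mul, hρρ, hρc, mul_comm]
  have hΘx : Θ (κ * ρ κ / c) = κ * ρ κ / c := by rw [map_div₀, map_mul, hΘκ, hΘρ, hΘκ, hΘc]
  have hx0 : κ * ρ κ / c ≠ 0 := div_ne_zero (mul_ne_zero hκ0 ((map_ne_zero ρ).2 hκ0)) hc
  have hρk : ρ (η * ρ η / (τ * τ)) = η * ρ η / (τ * τ) := by rw [map_div₀, map_mul, hρρ, mul_comm (ρ η) η, map_mul, hρτ]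
  have hΘk : Θ (η * ρ η / (τ * τ)) = η * ρ η / (τ * τ) := by rw [map_div₀, map_mul, hΘη, hΘρ, hΘη, map_mul, hΘτ]
  have hk0 : η * ρ η / (τ * τ) ≠ 0 := div_ne_zero (mul_ne_zero hη ((map_ne_zero ρ).2 hη)) (mul_ne_zero hτ hτ)
  -- `ηρη/τ²` is a non-norm: `τ² ∈ 𝒩`
  have hkn : ¬ ∃ e : M, ρ e = e ∧ e * Θ e = η * ρ η / (τ * τ) := by
    intro hk
    have hττ : ∃ e : M, ρ e = e ∧ e * Θ e = τ * τ := fixedNorm_sq hρτ hΘτ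
    have := fixedNorm_mul hk hττ
    rw [div_mul_cancel₀ _ (mul_ne_zero hτ hτ)] at this
    exact hηN this
  rw [fixedNorm_mul_iff_iff hρc₀ hΘc₀ hc₀n hdich hρx hΘx hx0 hρk hΘk hk0]
  exact ⟨fun h hx => hkn (h.1 hx), fun h => ⟨fun hx => absurd hx h, fun hk => absurd hk hkn⟩⟩

/-- **NEARBY POINTS HAVE THE SAME CLASS.**  `jE`-letters on a complete `E` with the wild datum (`|jE a| = |a|`); `ρ² = 1` isometric, `Θρ = ρΘ`; two
`Θ`-fixed points `κ ≠ 0`, `κ′` with `|κ′ − κ| ≤ |ϖ|^{2d−1}·|κ|; any scalar `c`.  THEN `N_ρ(κ′) ∕ c ∈ 𝒩 ↔ N_ρ(κ) ∕ c ∈ 𝒩` (`N_ρ(κ′∕κ) ≡ 1 (ϖ^{2d−1})` is a norm, §1). — The class predicate is constant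
on digit classes finer than `|ϖ|^{2d−1}·(radius)`. [cite: Serre1979, Ch. V §3 Prop. 5, Cor. 2–3 pp. 84–86; Ch. XV §2] -/
theorem classClause_iff_of_near [CompleteSpace E] {σ : E →+* E} {ϖ : E} {d tE : ℕ} (hD : IsRamifiedQuadraticDatum σ ϖ d tE)
    (jE : E →+* M) (hjfix : ∀ z, ρ z = z ↔ ∃ c, jE c = z) (hΘj : ∀ c, Θ (jE c) = jE (σ c)) (hjiso : ∀ a, Valued.v (jE a) = Valued.v a)
    (hρρ : ∀ x, ρ (ρ x) = x) (hvρ : ∀ x, Valued.v (ρ x) = Valued.v x) (hΘρ : ∀ x, Θ (ρ x) = ρ (Θ x))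
    (c : M) {κ κ' : M} (hΘκ : Θ κ = κ) (hΘκ' : Θ κ' = κ') (hκ0 : κ ≠ 0)
    (hnear : Valued.v (κ' - κ) ≤ Valued.v (jE ϖ) ^ (2 * d - 1) * Valued.v κ) :
    (∃ e : M, ρ e = e ∧ e * Θ e = κ' * ρ κ' / c) ↔ ∃ e : M, ρ e = e ∧ e * Θ e = κ * ρ κ / c := by
  obtain ⟨-, -, hϖ, -, -, hd1, -⟩ := id hD
  have hκpos : 0 < Valued.v κ := zero_lt_iff.2 ((Valuation.ne_zero_iff _).2 hκ0)
  have hϖlt : Valued.v (jE ϖ) ^ (2 * d - 1) < 1 := by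
    rw [hjiso, hϖ, ← exp_nsmul, nsmul_eq_mul, ← exp_zero, exp_lt_exp]; omega
  set z : M := (κ' - κ) / κ with hz
  have hzv : Valued.v z ≤ Valued.v (jE ϖ) ^ (2 * d - 1) := by
    rw [hz, map_div₀, div_le_iff₀ hκpos]; exact hnear
  have hz1 : Valued.v z < 1 := lt_of_le_of_lt hzv hϖlt
  have hκ' : κ' = κ * (1 + z) := by rw [hz]; field_simp; ring
  set u : M := (1 + z) * ρ (1 + z) with hu
  have hρu : ρ u = u := by rw [hu, map_mul, hρρ, mul_comm]
  have hΘz : Θ z = z := by rw [hz, map_div₀, map_sub, hΘκ', hΘκ]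
  have hΘu : Θ u = u := by rw [hu, map_mul, map_add, map_one, hΘz, hΘρ, map_add, map_one, hΘz]
  have hunear : Valued.v (u - 1) ≤ Valued.v (jE ϖ) ^ (2 * d - 1) := by
    have e : u - 1 = z + (ρ z + z * ρ z) := by rw [hu, map_add, map_one]; ring
    rw [e]
    refine (Valuation.map_add _ _ _).trans (max_le hzv ((Valuation.map_add _ _ _).trans (max_le (by rw [hvρ]; exact hzv) ?_)))
    rw [Valuation.map_mul, hvρ]
    calc Valued.v z * Valued.v z ≤ Valued.v z * 1 := by gcongr
      _ ≤ Valued.v (jE ϖ) ^ (2 * d - 1) := by rw [mul_one]; exact hzv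
  have huN : ∃ e : M, ρ e = e ∧ e * Θ e = u := fixedNorm_of_v_sub_one_le hD jE hjfix hΘj hjiso hρu hΘu hunear
  have h1z : 1 + z ≠ 0 := fun h0 => by
    have : Valued.v z = 1 := by
      have e : z = -1 := by linear_combination h0
      rw [e, Valuation.map_neg, Valuation.map_one]
    rw [this] at hz1; exact lt_irrefl _ hz1
  have hu0 : u ≠ 0 := mul_ne_zero h1z ((map_ne_zero ρ).2 h1z)
  have e2 : κ' * ρ κ' / c = κ * ρ κ / c * u := by rw [hκ', hu, map_mul]; ring
  rw [e2, fixedNorm_mul_iff hu0 huN]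

end Summit.HodgeConjecture.HodgeConjecture.Cruxes.H413.F0P3cDyRamRowCellDigitClassTwist

end
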